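import Summits.RiemannHypothesis.RiemannHypothesis.Theorems.GroundBartaPolarPerronFrobeniusEvenGainFubini
import Summits.RiemannHypothesis.RiemannHypothesis.Theorems.GroundBartaPolarPerronFrobeniusSignImproving
import HarnessLib

/-!
# RiemannHypothesis / GroundBarta — crux `PolarPerronFrobenius` (stmt-RiemannHypothesis-18390):
# even-sector sign improvement, part E3a: the truncated gain along the smooth approximants

Helper file (`--supports stmt-RiemannHypothesis-18390`), RH-free, Mathlib + proved tree files only,
no definitions, no named facts.  Notation: `f` real smooth compactly supported, `F = f`, `A = |f|`,
`W_η = ψ_η ∘ f = √(f² + η²) − η` (the smooth non-negative approximants of `|f|`, file `…SmoothAbs`),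
`D_t = weilIncrement`, `w = weilArchDensity`, truncated density `min(w, 5)`, and the TRUNCATED GAIN
`Γ_η = ∫_{(0,∞)} min(w(t),5) (D_t F − D_t W_η) dt`, `Γ_0` the same with `A` in place of `W_η`.

* `swe_abs_weilIncrement_psi_sub_le`: `|D_t(W_η) − D_t(A)| ≤ 8‖f‖₁ η` (both `ψ_η` and `|·|` are
  `1`-Lipschitz and `|ψ_η − |·|| ≤ η`);
* `swe_integrableOn_gain`: the gain integrands are integrable on `(0, ∞)` (dominated by `w · D_t F`);
* `swe_weilDirichletEnergy_sub_le_neg_gain`: **`𝓔_a(W_η) − 𝓔_a(F) ≤ −Γ_η`** (drop the prime part and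
  the excess `w − min(w,5)`, both against the non-negative `D_t F − D_t W_η`);
* `swe_tendsto_gain`: **`Γ_η → Γ_0` as `η → 0⁺`** (dominated convergence, bound `w · D_t F`);
* `swe_weilPoleForm_abs_sub_eq_even`: for EVEN `f`, `P(A) − P(F) = 8 (∫f⁺cosh(·/2)) (∫f⁻cosh(·/2))`
  (the `sinh`-pairings of the even functions `f^±` vanish).

Prover B, speedrun unit `sr-gb-rung-b` (seat 2).
-/

set_option linter.dupNamespace false

noncomputable section

open Set MeasureTheory Filter Complex
open scoped Real Topology

namespace Summit.RiemannHypothesis.RiemannHypothesis.Theorems.PolarPerronFrobenius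

open Literature.NumberTheory.LFunctions

section Approx

variable {f : ℝ → ℝ} {a η : ℝ}

/-- **Increments of the approximants converge, uniformly in `t`**:
`|D_t(W_η) − D_t(|f|)| ≤ 8 η ∫|f|` for `η > 0`. [folklore] -/
theorem swe_abs_weilIncrement_psi_sub_le (hf : ContDiff ℝ (⊤ : ℕ∞) f) (hfs : HasCompactSupport f)
    (hη : 0 < η) (t : ℝ) :
    |weilIncrement (fun x ↦ ((Real.sqrt (f x ^ 2 + η ^ 2) - η : ℝ) : ℂ)) t -
        weilIncrement (fun x ↦ ((|f x| : ℝ) : ℂ)) t| ≤ (8 * ∫ x, |f x|) * η := by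
  have hfc : Continuous f := hf.continuous
  have hW : IsWeilTest fun x ↦ ((Real.sqrt (f x ^ 2 + η ^ 2) - η : ℝ) : ℂ) :=
    sw_isWeilTest_psi_comp hf hfs hη
  have hAm : MemLp (fun x ↦ ((|f x| : ℝ) : ℂ)) 2 volume :=
    (Complex.continuous_ofReal.comp hfc.abs).memLp_of_hasCompactSupport
      ((hfs.abs).comp_left Complex.ofReal_zero)
  have iW := integrable_weilIncrement_integrand hW.memLp_two t
  have iA := integrable_weilIncrement_integrand hAm t
  have hfi : Integrable fun x ↦ |f x| := (hfc.abs).integrable_of_hasCompactSupport hfs.abs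
  have hfi' : Integrable fun x ↦ |f (x + t)| := hfi.comp_add_right t
  -- pointwise bound
  have hpt : ∀ x, |‖((Real.sqrt (f (x + t) ^ 2 + η ^ 2) - η : ℝ) : ℂ) -
        ((Real.sqrt (f x ^ 2 + η ^ 2) - η : ℝ) : ℂ)‖ ^ 2 -
      ‖((|f (x + t)| : ℝ) : ℂ) - ((|f x| : ℝ) : ℂ)‖ ^ 2| ≤ 4 * η * (|f (x + t)| + |f x|) := by
    intro x
    rw [← Complex.ofReal_sub, ← Complex.ofReal_sub, Complex.norm_real, Complex.norm_real,
      Real.norm_eq_abs, Real.norm_eq_abs, sq_abs, sq_abs]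
    set u := Real.sqrt (f (x + t) ^ 2 + η ^ 2) - η - (Real.sqrt (f x ^ 2 + η ^ 2) - η) with hu
    set v := |f (x + t)| - |f x| with hv
    have h1 : |u - v| ≤ 2 * η := by
      have e : u - v = (Real.sqrt (f (x + t) ^ 2 + η ^ 2) - η - |f (x + t)|) -
          (Real.sqrt (f x ^ 2 + η ^ 2) - η - |f x|) := by rw [hu, hv]; ring
      rw [e]
      have hA := sw_abs_psi_sub_abs_le hη.le (f (x + t))
      have hB := sw_abs_psi_sub_abs_le hη.le (f x)
      exact (abs_sub _ _).trans (by linarith)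
    have h2 : |u + v| ≤ 2 * (|f (x + t)| + |f x|) := by
      have hu' : |u| ≤ |f (x + t) - f x| := sw_abs_psi_sub_psi_le _ _ _
      have hv' : |v| ≤ |f (x + t) - f x| := by
        rw [hv]; exact abs_abs_sub_abs_le_abs_sub _ _
      have h3 : |f (x + t) - f x| ≤ |f (x + t)| + |f x| := abs_sub _ _
      calc |u + v| ≤ |u| + |v| := abs_add_le _ _
        _ ≤ 2 * (|f (x + t)| + |f x|) := by linarith
    have e2 : u ^ 2 - v ^ 2 = (u - v) * (u + v) := by ring
    rw [e2, abs_mul]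
    have := mul_le_mul h1 h2 (abs_nonneg _) (by linarith)
    linarith
  unfold weilIncrement
  rw [← integral_sub iW iA]
  calc |∫ x, (‖((Real.sqrt (f (x + t) ^ 2 + η ^ 2) - η : ℝ) : ℂ) -
          ((Real.sqrt (f x ^ 2 + η ^ 2) - η : ℝ) : ℂ)‖ ^ 2 -
        ‖((|f (x + t)| : ℝ) : ℂ) - ((|f x| : ℝ) : ℂ)‖ ^ 2)|
      ≤ ∫ x, |‖((Real.sqrt (f (x + t) ^ 2 + η ^ 2) - η : ℝ) : ℂ) -
          ((Real.sqrt (f x ^ 2 + η ^ 2) - η : ℝ) : ℂ)‖ ^ 2 -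
        ‖((|f (x + t)| : ℝ) : ℂ) - ((|f x| : ℝ) : ℂ)‖ ^ 2| := abs_integral_le_integral_abs
    _ ≤ ∫ x, 4 * η * (|f (x + t)| + |f x|) :=
        integral_mono_of_nonneg (Eventually.of_forall fun x ↦ abs_nonneg _)
          ((hfi'.add hfi).const_mul _) (Eventually.of_forall hpt)
    _ = (8 * ∫ x, |f x|) * η := by
        rw [integral_const_mul, integral_add hfi' hfi,
          integral_add_right_eq_self (μ := volume) (fun x ↦ |f x|) t]
        ring

/-- Pointwise convergence of the increments: `D_t(W_η) → D_t(|f|)` as `η → 0⁺`. [folklore] -/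
theorem swe_tendsto_weilIncrement_psi (hf : ContDiff ℝ (⊤ : ℕ∞) f) (hfs : HasCompactSupport f)
    (t : ℝ) :
    Tendsto (fun η : ℝ ↦ weilIncrement (fun x ↦ ((Real.sqrt (f x ^ 2 + η ^ 2) - η : ℝ) : ℂ)) t)
      (𝓝[>] 0) (𝓝 (weilIncrement (fun x ↦ ((|f x| : ℝ) : ℂ)) t)) :=
  sw_tendsto_of_norm_sub_le fun η hη ↦ by
    rw [Real.norm_eq_abs]
    exact swe_abs_weilIncrement_psi_sub_le hf hfs hη t

/-- The gain integrand `min(w,5)(D_t F − D_t G)` is integrable on `(0,∞)` whenever `G` is a test with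
`D_t G ≤ D_t F` (dominated by `w · D_t F`). [folklore] -/
theorem swe_integrableOn_gain {F G : ℝ → ℂ} (hF : IsWeilTest F) (hG : IsWeilTest G)
    (hle : ∀ t, weilIncrement G t ≤ weilIncrement F t) :
    IntegrableOn (fun t ↦ min (weilArchDensity t) 5 * (weilIncrement F t - weilIncrement G t))
      (Ioi 0) := by
  have hmeas : AEStronglyMeasurable
      (fun t ↦ min (weilArchDensity t) 5 * (weilIncrement F t - weilIncrement G t))
      (volume.restrict (Ioi 0)) :=
    ((measurable_weilArchDensity.min measurable_const).mul
      ((continuous_weilIncrement hF).sub (continuous_weilIncrement hG)).measurable).aestronglyMeasurable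
  refine Integrable.mono' (integrableOn_weilArchDensity_mul_weilIncrement hF) hmeas
    ((ae_restrict_iff' measurableSet_Ioi).2 (Eventually.of_forall fun t (ht : 0 < t) ↦ ?_))
  have hw0 := (weilArchDensity_pos ht).le
  have hD0 : 0 ≤ weilIncrement F t - weilIncrement G t := sub_nonneg.2 (hle t)
  have hDle : weilIncrement F t - weilIncrement G t ≤ weilIncrement F t := by
    linarith [weilIncrement_nonneg G t]
  rw [Real.norm_of_nonneg (mul_nonneg (le_min hw0 (by norm_num)) hD0)]
  exact mul_le_mul (min_le_left _ _) hDle hD0 hw0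

/-- `D_t(|f|) ≤ D_t(f)` (`|·|` is a normal contraction). [folklore] -/
theorem swe_weilIncrement_abs_le (hf : ContDiff ℝ (⊤ : ℕ∞) f) (hfs : HasCompactSupport f) (t : ℝ) :
    weilIncrement (fun x ↦ ((|f x| : ℝ) : ℂ)) t ≤ weilIncrement (fun x ↦ ((f x : ℝ) : ℂ)) t := by
  have hF : IsWeilTest fun x ↦ ((f x : ℝ) : ℂ) := sw_isWeilTest_ofReal_comp hf hfs
  have hcomp : (fun z : ℂ ↦ ((‖z‖ : ℝ) : ℂ)) ∘ (fun x ↦ ((f x : ℝ) : ℂ)) =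
      fun x ↦ ((|f x| : ℝ) : ℂ) := by
    funext x
    simp only [Function.comp_apply, Complex.norm_real, Real.norm_eq_abs]
  rw [← hcomp]
  refine weilIncrement_comp_le ?_ (integrable_weilIncrement_integrand hF.memLp_two t)
  exact LipschitzWith.of_dist_le_mul fun z w ↦ by
    simp only [NNReal.coe_one, one_mul, dist_eq_norm, ← Complex.ofReal_sub, Complex.norm_real,
      Real.norm_eq_abs]
    exact abs_norm_sub_norm_le z w

/-- **The Dirichlet energy pays at least the truncated gain**: for `η > 0`,
`𝓔_a(W_η) − 𝓔_a(F) ≤ −∫_{(0,∞)} min(w,5)(D_t F − D_t W_η) dt`. [folklore] -/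
theorem swe_weilDirichletEnergy_sub_le_neg_gain (hf : ContDiff ℝ (⊤ : ℕ∞) f)
    (hfs : HasCompactSupport f) (a : ℝ) (hη : 0 < η) :
    weilDirichletEnergy a (fun x ↦ ((Real.sqrt (f x ^ 2 + η ^ 2) - η : ℝ) : ℂ)) -
        weilDirichletEnergy a (fun x ↦ ((f x : ℝ) : ℂ)) ≤
      -∫ t in Ioi (0 : ℝ), min (weilArchDensity t) 5 *
        (weilIncrement (fun x ↦ ((f x : ℝ) : ℂ)) t -
          weilIncrement (fun x ↦ ((Real.sqrt (f x ^ 2 + η ^ 2) - η : ℝ) : ℂ)) t) := by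
  set W : ℝ → ℂ := fun x ↦ ((Real.sqrt (f x ^ 2 + η ^ 2) - η : ℝ) : ℂ) with hWdef
  set F : ℝ → ℂ := fun x ↦ ((f x : ℝ) : ℂ) with hFdef
  have hF : IsWeilTest F := sw_isWeilTest_ofReal_comp hf hfs
  have hW : IsWeilTest W := sw_isWeilTest_psi_comp hf hfs hη
  have hle : ∀ t, weilIncrement W t ≤ weilIncrement F t := sw_weilIncrement_psi_comp_le hf hfs η
  -- prime part
  have hprime : ∑ n ∈ weilPrimeIndex a, (ArithmeticFunction.vonMangoldt n : ℝ) / Real.sqrt n *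
        weilIncrement W (Real.log n) ≤
      ∑ n ∈ weilPrimeIndex a, (ArithmeticFunction.vonMangoldt n : ℝ) / Real.sqrt n *
        weilIncrement F (Real.log n) :=
    Finset.sum_le_sum fun n _ ↦ mul_le_mul_of_nonneg_left (hle _)
      (div_nonneg ArithmeticFunction.vonMangoldt_nonneg (Real.sqrt_nonneg _))
  -- archimedean part
  have iF := integrableOn_weilArchDensity_mul_weilIncrement hF
  have iW := integrableOn_weilArchDensity_mul_weilIncrement hW
  have iG := swe_integrableOn_gain hF hW hle
  have harch : (∫ t in Ioi (0 : ℝ), weilArchDensity t * weilIncrement W t) -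
      ∫ t in Ioi (0 : ℝ), weilArchDensity t * weilIncrement F t ≤
      -∫ t in Ioi (0 : ℝ), min (weilArchDensity t) 5 * (weilIncrement F t - weilIncrement W t) := by
    rw [← integral_sub iW iF, ← integral_neg]
    refine setIntegral_mono_on (iW.sub iF) iG.neg measurableSet_Ioi fun t (ht : 0 < t) ↦ ?_
    have hw0 := (weilArchDensity_pos ht).le
    have hD0 : 0 ≤ weilIncrement F t - weilIncrement W t := sub_nonneg.2 (hle t)
    have hmin : min (weilArchDensity t) 5 ≤ weilArchDensity t := min_le_left _ _
    nlinarith [mul_le_mul_of_nonneg_right hmin hD0]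
  unfold weilDirichletEnergy
  linarith

/-- **The truncated gain converges**: `Γ_η → Γ_0` as `η → 0⁺`, where
`Γ_η = ∫_{(0,∞)} min(w,5)(D_t F − D_t W_η)` and `Γ_0 = ∫_{(0,∞)} min(w,5)(D_t F − D_t |f|)`
(dominated convergence with bound `w · D_t F`). [folklore] -/
theorem swe_tendsto_gain (hf : ContDiff ℝ (⊤ : ℕ∞) f) (hfs : HasCompactSupport f) :
    Tendsto (fun η : ℝ ↦ ∫ t in Ioi (0 : ℝ), min (weilArchDensity t) 5 *
        (weilIncrement (fun x ↦ ((f x : ℝ) : ℂ)) t -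
          weilIncrement (fun x ↦ ((Real.sqrt (f x ^ 2 + η ^ 2) - η : ℝ) : ℂ)) t))
      (𝓝[>] 0)
      (𝓝 (∫ t in Ioi (0 : ℝ), min (weilArchDensity t) 5 *
        (weilIncrement (fun x ↦ ((f x : ℝ) : ℂ)) t - weilIncrement (fun x ↦ ((|f x| : ℝ) : ℂ)) t))) := by
  set F : ℝ → ℂ := fun x ↦ ((f x : ℝ) : ℂ) with hFdef
  have hF : IsWeilTest F := sw_isWeilTest_ofReal_comp hf hfs
  have hev : ∀ᶠ η : ℝ in 𝓝[>] 0, 0 < η := self_mem_nhdsWithin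
  refine tendsto_integral_filter_of_dominated_convergence
    (fun t ↦ weilArchDensity t * weilIncrement F t) ?_ ?_
    (integrableOn_weilArchDensity_mul_weilIncrement hF) ?_
  · filter_upwards [hev] with η hη
    have hW : IsWeilTest fun x ↦ ((Real.sqrt (f x ^ 2 + η ^ 2) - η : ℝ) : ℂ) :=
      sw_isWeilTest_psi_comp hf hfs hη
    exact ((measurable_weilArchDensity.min measurable_const).mul
      ((continuous_weilIncrement hF).sub (continuous_weilIncrement hW)).measurable).aestronglyMeasurable
  · filter_upwards [hev] with η hη
    refine (ae_restrict_iff' measurableSet_Ioi).2 (Eventually.of_forall fun t (ht : 0 < t) ↦ ?_)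
    have hle := sw_weilIncrement_psi_comp_le hf hfs η t
    have hw0 := (weilArchDensity_pos ht).le
    have hD0 : 0 ≤ weilIncrement F t -
        weilIncrement (fun x ↦ ((Real.sqrt (f x ^ 2 + η ^ 2) - η : ℝ) : ℂ)) t := sub_nonneg.2 hle
    rw [Real.norm_of_nonneg (mul_nonneg (le_min hw0 (by norm_num)) hD0)]
    refine mul_le_mul (min_le_left _ _) ?_ hD0 hw0
    linarith [weilIncrement_nonneg (fun x ↦ ((Real.sqrt (f x ^ 2 + η ^ 2) - η : ℝ) : ℂ)) t]
  · refine (ae_restrict_iff' measurableSet_Ioi).2 (Eventually.of_forall fun t _ ↦ ?_)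
    exact (tendsto_const_nhds.sub (swe_tendsto_weilIncrement_psi hf hfs t)).const_mul _

end Approx

/-! ## The polar side for even `f` -/

section Polar

variable {f : ℝ → ℝ}

/-- **Polar loss for even `f`**: `P(|f|) − P(f) = 8 (∫ f⁺cosh(·/2)) (∫ f⁻cosh(·/2))` for a real
continuous compactly supported EVEN `f` (`P(|f|) − P(f) = 8(C⁺C⁻ − S⁺S⁻)` in general, and the
`sinh`-pairings `S^±` of the even functions `f^±` vanish). [folklore] -/
theorem swe_weilPoleForm_abs_sub_eq_even (hfc : Continuous f) (hfs : HasCompactSupport f)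
    (hfe : ∀ t, f (-t) = f t) :
    weilPoleForm (fun t ↦ ((|f t| : ℝ) : ℂ)) - weilPoleForm (fun t ↦ ((f t : ℝ) : ℂ)) =
      8 * (∫ t, max (f t) 0 * Real.cosh (t / 2)) * ∫ t, max (-f t) 0 * Real.cosh (t / 2) := by
  have hcosh : Continuous fun t : ℝ ↦ Real.cosh (t / 2) :=
    Real.continuous_cosh.comp (continuous_id.div_const 2)
  have hsinh : Continuous fun t : ℝ ↦ Real.sinh (t / 2) :=
    Real.continuous_sinh.comp (continuous_id.div_const 2)
  set Cp : ℝ := ∫ t, max (f t) 0 * Real.cosh (t / 2) with hCp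
  set Cm : ℝ := ∫ t, max (-f t) 0 * Real.cosh (t / 2) with hCm
  set Sp : ℝ := ∫ t, max (f t) 0 * Real.sinh (t / 2) with hSp
  set Sm : ℝ := ∫ t, max (-f t) 0 * Real.sinh (t / 2) with hSm
  have e1 : ∫ t, ((|f t| : ℝ) : ℂ) * (Real.cosh (t / 2) : ℂ) = ((Cp + Cm : ℝ) : ℂ) :=
    sw_integral_abs_mul_eq hfc hfs hcosh
  have e2 : ∫ t, ((|f t| : ℝ) : ℂ) * (Real.sinh (t / 2) : ℂ) = ((Sp + Sm : ℝ) : ℂ) :=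
    sw_integral_abs_mul_eq hfc hfs hsinh
  have e3 : ∫ t, ((f t : ℝ) : ℂ) * (Real.cosh (t / 2) : ℂ) = ((Cp - Cm : ℝ) : ℂ) :=
    sw_integral_self_mul_eq hfc hfs hcosh
  have e4 : ∫ t, ((f t : ℝ) : ℂ) * (Real.sinh (t / 2) : ℂ) = ((Sp - Sm : ℝ) : ℂ) :=
    sw_integral_self_mul_eq hfc hfs hsinh
  have hP : weilPoleForm (fun t ↦ ((|f t| : ℝ) : ℂ)) - weilPoleForm (fun t ↦ ((f t : ℝ) : ℂ)) =
      8 * (Cp * Cm) - 8 * (Sp * Sm) := by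
    unfold weilPoleForm
    rw [e1, e2, e3, e4]
    simp only [Complex.norm_real, Real.norm_eq_abs, sq_abs]
    ring
  -- the `sinh`-pairings vanish by parity
  have hSp : Sp = 0 := by
    -- the integrand `t ↦ f⁺(t) sinh(t/2)` is odd (library lemma `trial_integral_odd_eq_zero` of
    -- `WeilParityOffLineParityDetectionTrialIntegrals`, re-derived inline to keep the import cone small)
    have h := integral_neg_eq_self (fun t ↦ max (f t) 0 * Real.sinh (t / 2)) volume
    have hodd : ∀ t, max (f (-t)) 0 * Real.sinh (-t / 2) = -(max (f t) 0 * Real.sinh (t / 2)) := by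
      intro t; rw [hfe, neg_div, Real.sinh_neg]; ring
    simp_rw [hodd, integral_neg] at h
    rw [hSp]; linarith
  rw [hP, hSp]
  ring

end Polar



end Summit.RiemannHypothesis.RiemannHypothesis.Theorems.PolarPerronFrobenius

end
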